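import Literature.MeasureTheory.RestrictedProduct.OrbitalEulerProduct   -- brings `ProductMeasureRestrict` (`eq_rpMeasure`, `rpMeasure_restrict_rpBox`, `rho`, `kap`); the sibling `HaarRescale` (one-place lemma) is not in the farm's warm closure, so its two `congr` one-liners are re-proved privately here
import Mathlib.MeasureTheory.Measure.WithDensity                                    -- ED. 2: `Measure.prod_smul_right`
import HarnessLib

/-!
# Restricted product measures, VII′: rescaling the local measures at FINITELY MANY places

Topic `MeasureTheory/RestrictedProduct`; namespace `Literature.MeasureTheory.RestrictedProduct`; the n-place twin of ★ `HaarRescale.rpMeasure_eq_smul`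
(one place).  THEOREMS ONLY (no definition, no instance, no notation, no named fact, no `sorry`); pure measure theory, Mathlib + the
`RestrictedProduct` files only.

If the local measures `ν′_i = c_i • ν_i` are rescaled by constants `c_i` with `c_i = 1` off the exceptional set `S₀` (so the level sets `K_i` keep mass
one off `S₀`), the restricted product measure of Guichardet [Guichardet1972, App. D §D.3] ∕ Tate's `dα = dα_S` [CasselsFrohlichANT1967, Ch. XV §3.3] rescales by
the finite product `∏_{i ∈ S₀} c_i` (`rpMeasure_smul_eq_prod_smul`): on every box `rpBox K S`, `S ⊇ S₀`, both sides are the glued product of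
`⊗_{i∈S} ν′_i = (∏_{i∈S} c_i) • ⊗_{i∈S} ν_i` (Mathlib `Measure.pi_pi`) with the SAME probability tail `ρ_S` (`rho_congr`: `ν′_i = ν_i` off `S`), and
`∏_{i∈S} c_i = ∏_{i∈S₀} c_i`.

USE (cell `pub/hodgecm-mathlib`, crux H413 = stmt-HodgeConjecture-24833, line LH5 of the h413 pay-down, brick for the «SCALAR-TRANSPORT» of the covolume letter (T′) of
★ `Rogawski1990.TamagawaSingularMembersFinTFCovol`: two systems of local centraliser partners proportional by scalars `a_v` with `a_v = 1` at almost every place give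
finite-adelic towers proportional by `∏ a_v`).  HC_CM is proved only modulo the printed citations until rung 0 closes; this file proves no printed statement.

* `rpMeasure_smul_eq_prod_smul` — `rpMeasure K ν′ S₀ = (∏ i ∈ S₀, c i) • rpMeasure K ν S₀` for `ν′_i = c_i • ν_i`, `c_i = 1` off `S₀`.
* ED. 2: `tower_smul_of_factors_smul` — GENERIC tower rescaling (slice (γ1) of the LH5 SCALAR-TRANSPORT): the five tower equations `ρ = f₁_* rpMeasure`, `ρM = f₂_* ρ`,
  `tf = f₃_* ρM`, `g_* tP = TF ⊗ tf`, `T = h_* tP` pass from factors `μ_i = a_i • μ⁰_i` (`a = 1` off `S ⊇ S₀`) to `μ⁰` over `S` with every measure divided by `∏_{i∈S} a_i`.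

## References
* [Guichardet1972] A. Guichardet, *Symmetric Hilbert spaces and related topics*, LNM 261 (1972), App. D §D.3, Definition D.3, p. 166.
* [CasselsFrohlichANT1967] J. W. S. Cassels, A. Fröhlich (eds.), *Algebraic Number Theory* (1967), Ch. XV (Tate), §3.3.
-/

set_option autoImplicit false

noncomputable section

open _root_.MeasureTheory Set Filter Function
open _root_.Topology

open scoped RestrictedProduct ENNReal NNReal

namespace Literature.MeasureTheory.RestrictedProduct

universe u v

section rescaleMany

variable {ι : Type u} {G : ι → Type v} [∀ i, MeasurableSpace (G i)] [Countable ι]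
  (K : ∀ i, Set (G i)) (hKne : ∀ i, (K i).Nonempty)

omit [Countable ι] in
/-- `κ_i` depends only on `ν_i` (private copy of ★ `HaarRescale.kap_congr`). [folklore] -/
private theorem kap_congr' {ν ν' : ∀ i, Measure (G i)} {i : ι} (h : ν' i = ν i) :
    kap K ν' hKne i = kap K ν hKne i := by
  unfold kap; rw [h]

omit [Countable ι] in
/-- `ρ_S` depends only on the `ν_i`, `i ∉ S` (private copy of ★ `HaarRescale.rho_congr`). [folklore] -/
private theorem rho_congr' {ν ν' : ∀ i, Measure (G i)} (S : Finset ι) (h : ∀ i, i ∉ S → ν' i = ν i) :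
    rho K ν' hKne S = rho K ν hKne S := by
  unfold rho
  congr 1
  funext i
  exact kap_congr' K hKne (h i i.2)

include hKne in
/-- **Rescaling the local measures at the places of `S₀` rescales the restricted product measure by the product of the constants**: if
`ν′_i = c_i • ν_i` for all `i` with `c_i = 1` off `S₀` (and the `ν_i` give the level sets `K_i` mass one off `S₀`), then
`rpMeasure K ν′ S₀ = (∏_{i ∈ S₀} c_i) • rpMeasure K ν S₀`.  (On each box `rpBox K S`, `S ⊇ S₀`: the glued product of `⊗_{i∈S} ν′_i = (∏_{i∈S} c_i) • ⊗_{i∈S} ν_i`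
with the common tail `ρ_S`; `∏_{i∈S} c_i = ∏_{i∈S₀} c_i`.) [cite: Guichardet1972, App. D §D.3, Definition D.3 p. 166] [cite: CasselsFrohlichANT1967, Ch. XV §3.3] -/
theorem rpMeasure_smul_eq_prod_smul (ν ν' : ∀ i, Measure (G i)) [∀ i, SigmaFinite (ν i)] [∀ i, SigmaFinite (ν' i)]
    (hKm : ∀ i, MeasurableSet (K i)) {S₀ : Finset ι} (hK1 : ∀ i, i ∉ S₀ → ν i (K i) = 1) (c : ι → ℝ≥0∞)
    (h : ∀ i, ν' i = c i • ν i) (hc : ∀ i, i ∉ S₀ → c i = 1) :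
    rpMeasure K ν' S₀ = (∏ i ∈ S₀, c i) • rpMeasure K ν S₀ := by
  classical
  have hne : ∀ i, i ∉ S₀ → ν' i = ν i := fun i hi => by rw [h i, hc i hi, one_smul]
  have hK1' : ∀ i, i ∉ S₀ → ν' i (K i) = 1 := fun i hi => by rw [hne i hi]; exact hK1 i hi
  symm
  refine eq_rpMeasure K ν' hKne hKm hK1' _ fun S hS => ?_
  haveI := isProbabilityMeasure_rho K ν hKne hKm S
  rw [Measure.restrict_smul, rpMeasure_restrict_rpBox K ν hKne hKm hK1 hS, ← Measure.map_smul,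
    ← Measure.prod_smul_left, rho_congr' K hKne S (fun i hi => hne i (fun h' => hi (hS h')))]
  congr 2
  symm
  refine Measure.pi_eq fun s _ => ?_
  rw [Measure.smul_apply, smul_eq_mul, Measure.pi_pi]
  -- `∏_{j ∈ S} ν′_j (s j) = ∏_{j ∈ S} c_j · ∏_{j ∈ S} ν_j (s j)` and `∏_{j ∈ S} c_j = ∏_{i ∈ S₀} c_i`
  have h1 : (∏ j : {i // i ∈ S}, ν' j (s j)) = (∏ j : {i // i ∈ S}, c j) * ∏ j : {i // i ∈ S}, ν j (s j) := by
    rw [← Finset.prod_mul_distrib]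
    refine Finset.prod_congr rfl fun j _ => ?_
    rw [h j, Measure.smul_apply, smul_eq_mul]
  have h2 : (∏ j : {i // i ∈ S}, c j) = ∏ i ∈ S₀, c i := by
    rw [Finset.prod_coe_sort S c]
    exact (Finset.prod_subset hS fun i _ hi => hc i hi).symm
  rw [h1, h2]

include hKne in
/-- The same with the constants in `ℝ≥0` (the currency of Haar rescalings `a • t`). [cite: Guichardet1972, App. D §D.3, Definition D.3 p. 166] -/
theorem rpMeasure_nnreal_smul_eq_prod_smul (ν ν' : ∀ i, Measure (G i)) [∀ i, SigmaFinite (ν i)] [∀ i, SigmaFinite (ν' i)]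
    (hKm : ∀ i, MeasurableSet (K i)) {S₀ : Finset ι} (hK1 : ∀ i, i ∉ S₀ → ν i (K i) = 1) (c : ι → ℝ≥0)
    (h : ∀ i, ν' i = c i • ν i) (hc : ∀ i, i ∉ S₀ → c i = 1) :
    rpMeasure K ν' S₀ = (∏ i ∈ S₀, c i) • rpMeasure K ν S₀ := by
  have h' : ∀ i, ν' i = (c i : ℝ≥0∞) • ν i := fun i => by rw [h i, ENNReal.smul_def]
  have hc' : ∀ i, i ∉ S₀ → (c i : ℝ≥0∞) = 1 := fun i hi => by rw [hc i hi, ENNReal.coe_one]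
  rw [rpMeasure_smul_eq_prod_smul K hKne ν ν' hKm hK1 (fun i => (c i : ℝ≥0∞)) h' hc', ENNReal.smul_def, ENNReal.ofNNReal_finsetProd]

end rescaleMany

/-! ## ED. 2 — the GENERIC TOWER RESCALING (slice (γ1) of the LH5 SCALAR-TRANSPORT) -/

section TowerRescale

variable {ι : Type u} {G : ι → Type v} [∀ i, MeasurableSpace (G i)] [Countable ι]
  (K : ∀ i, Set (G i)) (hKne : ∀ i, (K i).Nonempty) (hKm : ∀ i, MeasurableSet (K i))

include hKne hKm in
/-- **(γ1) GENERIC TOWER RESCALING.**  Abstract tower: `ρ = f₁_* (rpMeasure K μ S₀)`, `ρM = f₂_* ρ`, `tf = f₃_* ρM`, `g_* tP = TF ⊗ tf`, `T = h_* tP`.  If the local factors are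
`μ_i = a_i • μ⁰_i` with `a_i = 1` off a finite `S ⊇ S₀`, `a_i ≠ 0` on `S`, and `μ_i (K_i) = 1` off `S₀`, then with `A := ∏_{i ∈ S} a_i` (≠ 0) the RESCALED data
`A⁻¹ • ρ, A⁻¹ • ρM, A⁻¹ • tf, A⁻¹ • tP, A⁻¹ • T` satisfy the same five equations for the source factors `μ⁰` over `S` (and `μ⁰_i (K_i) = 1` off `S`):
★ `rpMeasure_eq_of_subset` (enlarge `S₀ ⊆ S`) + ★ `rpMeasure_nnreal_smul_eq_prod_smul` (rescale) + `Measure.map_smul` + `Measure.prod_smul_right`.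
[cite: Guichardet1972, App. D §D.3, Definition D.3 p. 166] [cite: CasselsFrohlichANT1967, Ch. XV §3.3] -/
theorem tower_smul_of_factors_smul
    {X₁ X₂ X₃ Y P Z : Type*} [MeasurableSpace X₁] [MeasurableSpace X₂] [MeasurableSpace X₃] [MeasurableSpace Y] [MeasurableSpace P] [MeasurableSpace Z]
    (f₁ : (Πʳ i, [G i, K i]) → X₁) (f₂ : X₁ → X₂) (f₃ : X₂ → X₃) (g : P → Y × X₃) (h : P → Z)
    (μ₀ μ : ∀ i, Measure (G i)) [∀ i, SigmaFinite (μ₀ i)] [∀ i, SigmaFinite (μ i)]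
    (a : ι → ℝ≥0) {S₀ S : Finset ι} (hS : S₀ ⊆ S) (hμ : ∀ i, μ i = a i • μ₀ i) (ha1 : ∀ i, i ∉ S → a i = 1) (ha0 : ∀ i ∈ S, a i ≠ 0)
    (hK1 : ∀ i, i ∉ S₀ → μ i (K i) = 1)
    (TF : Measure Y) (ρ : Measure X₁) (ρM : Measure X₂) (tf : Measure X₃) [SFinite tf] (tP : Measure P) (T : Measure Z)
    (hρ : ρ = Measure.map f₁ (rpMeasure K μ S₀)) (hρM : ρM = Measure.map f₂ ρ) (htf : tf = Measure.map f₃ ρM)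
    (htP : Measure.map g tP = TF.prod tf) (hT : T = Measure.map h tP) :
    (∀ i, i ∉ S → μ₀ i (K i) = 1) ∧
      (∏ i ∈ S, a i)⁻¹ • ρ = Measure.map f₁ (rpMeasure K μ₀ S) ∧
      (∏ i ∈ S, a i)⁻¹ • ρM = Measure.map f₂ ((∏ i ∈ S, a i)⁻¹ • ρ) ∧
      (∏ i ∈ S, a i)⁻¹ • tf = Measure.map f₃ ((∏ i ∈ S, a i)⁻¹ • ρM) ∧
      Measure.map g ((∏ i ∈ S, a i)⁻¹ • tP) = TF.prod ((∏ i ∈ S, a i)⁻¹ • tf) ∧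
      (∏ i ∈ S, a i)⁻¹ • T = Measure.map h ((∏ i ∈ S, a i)⁻¹ • tP) := by
  classical
  have hA0 : (∏ i ∈ S, a i) ≠ 0 := Finset.prod_ne_zero_iff.2 ha0
  -- the source level sets have mass one off `S`
  have hK1₀ : ∀ i, i ∉ S → μ₀ i (K i) = 1 := by
    intro i hi
    have h1 := hK1 i (fun h' => hi (hS h'))
    rwa [hμ i, ha1 i hi, one_smul] at h1
  -- the finite-adelic factor: enlarge the exceptional set, then rescale place by place
  have hrp : rpMeasure K μ S₀ = (∏ i ∈ S, a i) • rpMeasure K μ₀ S := by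
    rw [rpMeasure_eq_of_subset K μ hKne hKm hS hK1]
    exact rpMeasure_nnreal_smul_eq_prod_smul K hKne μ₀ μ hKm hK1₀ a hμ ha1
  refine ⟨hK1₀, ?_, ?_, ?_, ?_, ?_⟩
  · rw [hρ, hrp, Measure.map_smul, smul_smul, inv_mul_cancel₀ hA0, one_smul]
  · rw [Measure.map_smul, ← hρM]
  · rw [Measure.map_smul, ← htf]
  · rw [Measure.map_smul, htP, Measure.prod_smul_right]
  · rw [Measure.map_smul, ← hT]

end TowerRescale

end Literature.MeasureTheory.RestrictedProduct

end
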